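import Summits.QuantumFields.YangMills.Theorems.UnitScaleTiltProp7NestedMeanTowerClosenessT3
import Summits.QuantumFields.YangMills.Theorems.UnitScaleTiltProp7TwistDefectOfRegPr
import Summits.QuantumFields.YangMills.Theorems.UnitScaleTiltProp8ChartIterSmall
import HarnessLib

/-!
# Route `UnitScaleTilt`, crux K1 «MinimiserStabilityRegPr» (stmt-QuantumFields-19200), route-R E′, ★★OWNER RULING g28-№13 (A′) HCOW-VIA-Σ, package P-A2 «JOINT-Σ», row F1″ —
# «BG-READS»: THE AVERAGED BACKGROUND TOWER OF A PRINTED-REGULAR `U₀` IS BOND-SMALL AT EVERY LEVEL UNDER A TOP BOND, IN THE TOP COMB GAUGE, k-UNIFORMLY: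
# `‖Ū₀ˡ[σ_ĉ•U₀](e) − 1‖ ≤ 450L·ε₀·Lˡ·L^{−(K−n)} ≤ 450L·ε₀` for every level-`l` bond `e` under the two `(K−n)`-blocks of `ĉ`, all `l ≤ K − n`

Cell `ym3-torus`, width seat `ym3-torus-px15` (gen 3); `--supports stmt-QuantumFields-19200 --as helper`, count-neutral; the core-independent half of the «F1″-COV-T3 READING»
offered by routeR-w6 g7 (F1″ pen) to this seat (LOCATE `LOCATE-F1COV-T3-px15g3.md` §1).  YM₃ on T³ is a ladder rung (R3), not the Clay problem; nothing here claims a mass gap.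

WHY.  F1″ (★routeR-w3 g6 LOCATE bc08ddff §2) bounds the one-step second-order defect of the covariant twisted average `dbarCovU Ū₀ˡ (·)` at level `l`, whose BACKGROUND is the `l`-fold
averaged tower `Ū₀ˡ = emlIterU l U₀♭` of the member's background; every one-step row of the tree (✓`Prop7SymFrameOneStep.norm_dbarCovU_mul_inv_sub_one_le`, routeR-w6's F1″ core) asks that
background to be BOND-small on the two blocks of the coarse bond.  At a printed-regular `U₀` ([Balaban1985Variational] (2): plaquettes within `ε₀L^{−2(K−n)}` of `1`) this holds in the comb gauge
from the centre of the top bond's source block, uniformly in the level: the gauge makes `U₀` itself `3ε₀L^{−(K−n)}`-flat under the two top blocks (✓`Prop7TwistDefectOfRegPr.flat_centreAxial_of_regPr`),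
and the averaged tower inherits reads `30ℓ·Lˡ·s₀` (✓`Prop8Chart.norm_emlIterU_sub_one_le_of_reads`, [Balaban1985Averaging] Prop. 4) under the budget `6400ℓ²Lˡs₀ ≤ 1`, which the member window
`10⁷L³ε₀ ≤ 1` pays (`ℓ = 5L` at `d = 3`).
* §0 `iterBlockOf_add_eq_of_eq` (the `(l+t)`-block depends only on the `l`-block), `mem_top_of_iterBlockOf_mem` (a fine bond whose `l`-block lies under `ĉ` lies under `ĉ`).
* §1 ★★ `norm_emlIterU_gauged_sub_one_le_of_regPr` (the title, level-resolved bound `450L·ε₀·Lˡ·L^{−(K−n)}`), ★★ `norm_emlIterU_gauged_sub_one_le_of_regPr'` (k-uniform `450L·ε₀`),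
  `budget_bgReads` (the numerals).
HONEST SCOPE: composition of landed letters with explicit numerals; only the two-cell no-wrap margin `hN4` of ✓`flat_centreAxial_of_regPr` is displayed.  Sorry-free, no `def`, no `instance`.

References: T. Bałaban, CMP 102 (1985) 277–309 [Balaban1985Variational] ((2) p.278, (146) p.301); CMP 98 (1985) 17–51 [Balaban1985Averaging] ((8)–(12) p.19, pp.24–25, Prop. 4 (134)–(135) p.38);
CMP 99 (1985) 75–102 [Balaban1985RegularSpaces] (Lemma 1 (1.25) p.79).
-/

set_option autoImplicit false

noncomputable section

open scoped BigOperators Matrix.Norms.L2Operator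

namespace Summit.QuantumFields.YangMills.Theorems.Prop7TowerBgReadsOfRegPr

open Literature.MathematicalPhysics.QuantumFieldTheory.Balaban1983to89
open Literature.MathematicalPhysics.QuantumFieldTheory.Balaban1983to89.T3ContinuumYM3Torus
open T3PrintedRegularMinimiser (RegPr)
open T3SectALandauChart (pos_of_regPr bgUnits)
open B5Eq118OneStroke (iterBlockOf iterBlockOf_succ)
open B15DeterminingSets (embIter)
open B10Eq38TorusDomains (toFine)
open B10Eq27TorusAxialLog (axialT gaugeActT gaugeActT_eq_gaugeAct)
open T4Continuum
open Summit.QuantumFields.YangMills.Theorems.AbelianEML.Tensor (le_standing)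
open Summit.QuantumFields.YangMills.Theorems.Prop8Chart (emlIterU norm_emlIterU_sub_one_le_of_reads)
open Summit.QuantumFields.YangMills.Theorems.Prop7TwistDefectOfRegPr (flat_centreAxial_of_regPr)
open Summit.QuantumFields.YangMills.Theorems.Prop7NestedMeanTowerCloseness (coe_gaugeActT_axialT_bgUnits)

variable (F : T3Family) (n K : ℕ)
variable {F n K}

/-! ## §0 Block bookkeeping -/

/-- The `(l + t)`-block of a finest site depends only on its `l`-block. [folklore] -/
theorem iterBlockOf_add_eq_of_eq {l : ℕ} {x x' : Site (F.P K) 0} (h : iterBlockOf l x = iterBlockOf l x') :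
    ∀ t : ℕ, iterBlockOf (l + t) x = iterBlockOf (l + t) x'
  | 0 => h
  | t + 1 => by
    rw [Nat.add_succ, iterBlockOf_succ, iterBlockOf_succ, iterBlockOf_add_eq_of_eq h t]

/-- A finest site whose `l`-block (read through the block centre `embIter l`) lies under the level-`k` bond `ĉ` lies under `ĉ` (`l ≤ k`).
(`iterBlockOf_embIter` is the tree's `B^l(ι_l z) = z`.) [folklore] -/
theorem mem_top_of_iterBlockOf_mem {l k : ℕ} (hl' : l ≤ (F.P K).m + (F.P K).K) (hlk : l ≤ k) (ĉ : PBond (F.P K) k) (x : Site (F.P K) 0)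
    (hx : iterBlockOf k (embIter l (iterBlockOf l x)) = ĉ.src ∨ iterBlockOf k (embIter l (iterBlockOf l x)) = ĉ.tgt) :
    iterBlockOf k x = ĉ.src ∨ iterBlockOf k x = ĉ.tgt := by
  have h0 : iterBlockOf l (embIter l (iterBlockOf l x)) = iterBlockOf l x :=
    Literature.MathematicalPhysics.QuantumFieldTheory.BalabanImbrieJaffe1984to88.BIJ88RT51Background.iterBlockOf_embIter l hl' _
  obtain ⟨t, rfl⟩ := Nat.exists_eq_add_of_le hlk
  rwa [iterBlockOf_add_eq_of_eq h0 t] at hx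

/-! ## §1 The reads of the gauged background tower under a top bond -/

/-- the numerals: `6400·(5L)²·Lˡ·(3ε₀L^{−(K−n)}) ≤ 1` for `l ≤ K − n` under `10⁷L³ε₀ ≤ 1`. [cite: Balaban1985Variational, (146) p.301] -/
theorem budget_bgReads {ε₀ : ℝ} (hε₀ : 0 ≤ ε₀) (hε : 10 ^ 7 * (F.L : ℝ) ^ 3 * ε₀ ≤ 1) {l : ℕ} (hl : l ≤ K - n) :
    6400 * ((((F.P K).d + 2) * (F.P K).L : ℕ) : ℝ) ^ 2 * ((F.P K).L : ℝ) ^ l * (3 * ε₀ * ((F.L : ℝ) ^ (K - n))⁻¹) ≤ 1 := by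
  have hd : (F.P K).d = 3 := T3Family.P_d F K
  have hLn : ((F.P K).L : ℝ) = F.L := rfl
  have hL3 : (3 : ℝ) ≤ F.L := by
    have : 3 ≤ F.L := by obtain ⟨a, ha⟩ := F.hL.1; have := F.hL.2; omega
    exact_mod_cast this
  have hL0 : (0 : ℝ) < F.L := by linarith
  rw [hd]
  push_cast
  simp only [hLn]
  have hpow : (F.L : ℝ) ^ l * ((F.L : ℝ) ^ (K - n))⁻¹ ≤ 1 := by
    rw [← div_eq_mul_inv, div_le_one (by positivity)]
    exact pow_le_pow_right₀ (by linarith) hl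
  have h1 : 6400 * (5 * (F.L : ℝ)) ^ 2 * (F.L : ℝ) ^ l * (3 * ε₀ * ((F.L : ℝ) ^ (K - n))⁻¹)
      = 480000 * (F.L : ℝ) ^ 2 * ε₀ * ((F.L : ℝ) ^ l * ((F.L : ℝ) ^ (K - n))⁻¹) := by ring
  rw [h1]
  have h2 : 480000 * (F.L : ℝ) ^ 2 * ε₀ * ((F.L : ℝ) ^ l * ((F.L : ℝ) ^ (K - n))⁻¹) ≤ 480000 * (F.L : ℝ) ^ 2 * ε₀ :=
    mul_le_of_le_one_right (by positivity) hpow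
  have h3 : 480000 * (F.L : ℝ) ^ 2 * ε₀ ≤ 10 ^ 7 * (F.L : ℝ) ^ 3 * ε₀ := by
    have : (F.L : ℝ) ^ 2 ≤ (F.L : ℝ) ^ 3 := pow_le_pow_right₀ (by linarith) (by norm_num)
    nlinarith [pow_nonneg hL0.le 2]
  linarith

/-- ★★ **BG-READS, LEVEL-RESOLVED**: for a member `(F, n, K)`, `U₀ ∈ RegPr F n K ε₀`, `10⁷L³ε₀ ≤ 1`, the two-cell no-wrap margin `4·L^{K−n} ≤ sitesPerDir 0`, a top bond `ĉ` of level `K − n`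
and its comb gauge `σ_ĉ := axialT U₀♭ (toFine (K−n) ĉ.src)`: for every level `l ≤ K − n` and every level-`l` bond `e` whose ends (read through their block centres) lie under the two top
blocks of `ĉ`, the `l`-fold averaged GAUGED background is within `450L·ε₀·Lˡ·L^{−(K−n)}` of `1` at `e` — the background hypothesis of every covariant one-step row at level `l`.
[cite: Balaban1985Variational, (2) p.278; Balaban1985Averaging, (8)-(12) p.19, pp.24-25, Prop. 4 (134)-(135) p.38; Balaban1985RegularSpaces, Lemma 1 (1.25) p.79] -/
theorem norm_emlIterU_gauged_sub_one_le_of_regPr {ε₀ : ℝ} (hε : 10 ^ 7 * (F.L : ℝ) ^ 3 * ε₀ ≤ 1)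
    {U₀ : GaugeField (F.P K) 0 (Matrix.specialUnitaryGroup (Fin 2) ℂ)} (hreg : RegPr F n K ε₀ U₀)
    (hN4 : 4 * (F.P K).L ^ (K - n) ≤ (F.P K).sitesPerDir 0) (ĉ : PBond (F.P K) (K - n)) {l : ℕ} (hl : l ≤ K - n) (e : PBond (F.P K) l)
    (hs : iterBlockOf (K - n) (embIter l e.src) = ĉ.src ∨ iterBlockOf (K - n) (embIter l e.src) = ĉ.tgt)
    (ht : iterBlockOf (K - n) (embIter l e.tgt) = ĉ.src ∨ iterBlockOf (K - n) (embIter l e.tgt) = ĉ.tgt) :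
    ‖((emlIterU l (gaugeActT (axialT (bgUnits F K U₀) (toFine (K - n) ĉ.src)) (bgUnits F K U₀)) e : (Matrix (Fin 2) (Fin 2) ℂ)ˣ) : Matrix (Fin 2) (Fin 2) ℂ) - 1‖
      ≤ 450 * (F.L : ℝ) * ε₀ * (((F.P K).L : ℝ) ^ l * ((F.L : ℝ) ^ (K - n))⁻¹) := by
  have hε₀ : 0 < ε₀ := pos_of_regPr F hreg
  have hl' : l ≤ (F.P K).m + (F.P K).K := le_standing (hl.trans (Nat.sub_le K n))
  have hs₀ : 0 ≤ 3 * ε₀ * ((F.L : ℝ) ^ (K - n))⁻¹ := by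
    have : (0 : ℝ) < F.L := by have := F.hL.2; exact_mod_cast (by omega : 0 < F.L)
    positivity
  -- the level-0 reads under `ĉ` in the gauge (✓ flat_centreAxial_of_regPr), phrased on the site set of level `l`
  have hU : ∀ b : PBond (F.P K) 0,
      iterBlockOf l b.src ∈ {z : Site (F.P K) l | iterBlockOf (K - n) (embIter l z) = ĉ.src ∨ iterBlockOf (K - n) (embIter l z) = ĉ.tgt} →
      iterBlockOf l b.tgt ∈ {z : Site (F.P K) l | iterBlockOf (K - n) (embIter l z) = ĉ.src ∨ iterBlockOf (K - n) (embIter l z) = ĉ.tgt} →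
      ‖((gaugeActT (axialT (bgUnits F K U₀) (toFine (K - n) ĉ.src)) (bgUnits F K U₀) b : (Matrix (Fin 2) (Fin 2) ℂ)ˣ) : Matrix (Fin 2) (Fin 2) ℂ) - 1‖
        ≤ 3 * ε₀ * ((F.L : ℝ) ^ (K - n))⁻¹ := by
    intro b hbs hbt
    rw [Set.mem_setOf_eq] at hbs hbt
    rw [coe_gaugeActT_axialT_bgUnits, gaugeActT_eq_gaugeAct]
    exact flat_centreAxial_of_regPr F hreg hN4 ĉ b (mem_top_of_iterBlockOf_mem hl' hl ĉ _ hbs) (mem_top_of_iterBlockOf_mem hl' hl ĉ _ hbt)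
  have h := norm_emlIterU_sub_one_le_of_reads hl'
    {z : Site (F.P K) l | iterBlockOf (K - n) (embIter l z) = ĉ.src ∨ iterBlockOf (K - n) (embIter l z) = ĉ.tgt}
    (gaugeActT (axialT (bgUnits F K U₀) (toFine (K - n) ĉ.src)) (bgUnits F K U₀)) hs₀ (budget_bgReads hε₀.le hε hl) hU e hs ht
  refine h.trans (le_of_eq ?_)
  have hd : (F.P K).d = 3 := T3Family.P_d F K
  have hLn : ((F.P K).L : ℝ) = F.L := rfl
  rw [hd]
  push_cast
  rw [hLn]
  ring

/-- ★★ **BG-READS, k-UNIFORM**: under the same hypotheses the gauged averaged background is within `450L·ε₀` of `1` at every level `l ≤ K − n` under `ĉ` (since `Lˡ ≤ L^{K−n}`) — the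
L-only, level-free smallness the F1″ core consumes. [cite: Balaban1985Variational, (2) p.278, (146) p.301; Balaban1985Averaging, Prop. 4 (134)-(135) p.38] -/
theorem norm_emlIterU_gauged_sub_one_le_of_regPr' {ε₀ : ℝ} (hε : 10 ^ 7 * (F.L : ℝ) ^ 3 * ε₀ ≤ 1)
    {U₀ : GaugeField (F.P K) 0 (Matrix.specialUnitaryGroup (Fin 2) ℂ)} (hreg : RegPr F n K ε₀ U₀)
    (hN4 : 4 * (F.P K).L ^ (K - n) ≤ (F.P K).sitesPerDir 0) (ĉ : PBond (F.P K) (K - n)) {l : ℕ} (hl : l ≤ K - n) (e : PBond (F.P K) l)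
    (hs : iterBlockOf (K - n) (embIter l e.src) = ĉ.src ∨ iterBlockOf (K - n) (embIter l e.src) = ĉ.tgt)
    (ht : iterBlockOf (K - n) (embIter l e.tgt) = ĉ.src ∨ iterBlockOf (K - n) (embIter l e.tgt) = ĉ.tgt) :
    ‖((emlIterU l (gaugeActT (axialT (bgUnits F K U₀) (toFine (K - n) ĉ.src)) (bgUnits F K U₀)) e : (Matrix (Fin 2) (Fin 2) ℂ)ˣ) : Matrix (Fin 2) (Fin 2) ℂ) - 1‖
      ≤ 450 * (F.L : ℝ) * ε₀ := by
  have hε₀ : 0 < ε₀ := pos_of_regPr F hreg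
  have hLn : ((F.P K).L : ℝ) = F.L := rfl
  have hL1 : (1 : ℝ) ≤ F.L := by have := F.hL.2; exact_mod_cast (by omega : 1 ≤ F.L)
  have hpow : ((F.P K).L : ℝ) ^ l * ((F.L : ℝ) ^ (K - n))⁻¹ ≤ 1 := by
    rw [hLn, ← div_eq_mul_inv, div_le_one (by positivity)]
    exact pow_le_pow_right₀ hL1 hl
  have h := norm_emlIterU_gauged_sub_one_le_of_regPr hε hreg hN4 ĉ hl e hs ht
  exact h.trans (mul_le_of_le_one_right (by positivity) hpow)

end Summit.QuantumFields.YangMills.Theorems.Prop7TowerBgReadsOfRegPr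

end
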